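import Summits.CriticalPhenomena.SAWScalingLimit.Theses.SAWTotalPositivity
import Summits.CriticalPhenomena.SAWScalingLimit.Theorems.SAWTotalPositivityCriticalBubbleBoundKestenDefs
import Summits.CriticalPhenomena.SAWScalingLimit.Theorems.SAWTotalPositivityCriticalBubbleBoundKestenCutSum
import Summits.CriticalPhenomena.SAWScalingLimit.Theorems.SAWTotalPositivityCriticalBubbleBoundKestenCutPolygon
import Summits.CriticalPhenomena.SAWScalingLimit.Theorems.SAWTotalPositivityCriticalBubbleBoundKestenColumnMassLeOne
import Summits.CriticalPhenomena.SAWScalingLimit.Theorems.SAWTotalPositivityCriticalBubbleBoundKestenReduction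
import Literature.Probability.RandomPlanarGeometry.SAWWordBridges
import HarnessLib.Audit

/-!
# Line `kesten-product-renewal-dictionary` — crux `CriticalBubbleBound` (stmt-CriticalPhenomena-7117)

LEAD'S COPY (prover-line-stmt-CriticalPhenomena-7117-c5-0, continuation seat c5 of seats -1 / c1 / c2 / c3 / c4;
`work/CriticalBubbleBound.lean`, re-published to `Cruxes/CriticalBubbleBound/Lines/kesten_product_renewal_dictionary.lean`
after every reshape).

**STATUS (c5, 2026-08-17): composition UNCHANGED; sorry-free except the two OPEN exponent stubs B1
`stub_pinnedLengthMassBound : PinnedLengthMassBound (1/5)` and C `stub_disjointnessGain : DisjointnessGain (5/4)`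
(both research-level; census in the lead's NOTES.md). c5 PROGRAMME — MADRAS 1991 / MADRAS–SLADE §8.1 FOR `ℤ²`
(`α_sing ≤ 3/2`): the ONE-BRIDGE renewal dictionary and TRANSVERSAL ANTI-CONCENTRATION of Kesten's renewal walk,
giving for every non-increasing `h ≥ 0` the bound `Σ_N h_N q_N x_c^N ≤ C Σ_N h_N N^{-1/2}` (MS Cor. 8.1.5), hence
`Σ_{N≤M} q_N x_c^N = O(√M)`, `Σ_N N^{-s} q_N x_c^N < ∞ (s > 1/2)`, `q_N x_c^N = O(√N)`, rooted terms
`t_n = c_n(0,e₀) x_c^n = O(n^{3/2})`, dyadic blocks `R_i = O(2^{3i/2})` — the first POLYNOMIAL restrictive estimate on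
the crux's one number in the tree (proved window so far: stretched exponentials, Disproof §16). Infrastructure stubs
(registered on the crux item with `stub-add`, statements `C5.*` below, elaborated here; files
`Theorems/SAWTotalPositivityCriticalBubbleBoundKestenMS*.lean`, namespace `…Theorems.CriticalBubbleBound.Kesten.MS`):
A `ms_canon_le_upArch` (canonical SAP words ↪ up-first arches `0 → e₀` in `{y ≥ 0}`), B `ms_upArch_le_pinnedBridges`
(MS Prop. 8.1.2: reflect after the first topmost vertex ⇒ `N`-step bridges with transversal displacement `1`,
injective), C `ms_irrBridge_reflect` (y-reflection involution on irreducible bridges; `EN` is irreducible),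
D `ms_littlewoodOfford` (sign patterns with given signed sum `≤ √2·2^m/√(K+1)`, Erdős–Littlewood–Offord via Sperner),
E `ms_signAveraging` (symmetric product weights: charge-`y` mass `≤ √2·Σ Πμ·(K+1)^{-1/2}`), F `ms_binomialMoment`
(`Σ Πμ (K+1)^{-1/2} ≤ (p(m+1))^{-1/2}` for a sub-probability product weight), G `ms_irrFactorisation` (Kesten's full
factorisation `Σ_m Irr^m ≃ self-avoiding bridge words`), H `ms_pinnedBridgeMass_antitone` (lead; MS Prop. 8.1.4 in the
word model). ALL LANDED (wave 1, 2026-08-17, every worker first try): A p133147, B p133532, C p133116, D p133262,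
E p133151, F p133327, G p133114, H p133874 (`…KestenMSBridgeMass.lean`), TARGET `ms_polygon_antitone` p134428
(`…KestenMSPolygon.lean`: MS Cor. 8.1.5 `Σ_N h(N) q_N x_c^N ≤ 2√2μ Σ_m h(m)(m+1)^{-1/2}`; `ms_polygon_partialSum_le`
`Σ_{N≤M} q_N x_c^N ≤ 4√2μ√(M+1)`; `ms_polygonSeries_partialSum_le` `= O(M^{3/2})` for the crux's own partial sums;
`ms_polygon_rpow_series_ne_top` `Σ (N+1)^{-s} q_N x_c^N < ∞`, `s > 1/2`), span-sliced companion `ms_bridgeSpan_antitone`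
p134486 (`…KestenMSSpan.lean`: `Σ_h φ(h) u_h(y) ≤ (√2/x_c) Σ_m φ(m)(m+1)^{-1/2}`, pinned renewal function
`Σ_{h≤H} u_h(y) ≤ 2√2μ√(H+1)` uniformly in `y` — averaged TipAntiConcentration), rooted corollaries `ms_blockMass_term_le`
(`…KestenMSRooted.lean`: `t_n ≤ 8√2μ²(n+1)√(n+2)`, `R_i ≤ 16√2μ² 2^i √(2^{i+1}+1) = O(2^{3i/2})`; pending the farm
build at this writing). History of seats -1 … c4 (cut A1/A2, Kesten bound B2, reduction, strip gap, HW product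
bound, Kesten identity, renewal equalities): `Cruxes/CriticalBubbleBound/NOTES.md` §8–§10; this seat: §11.**

**Crux** (route SAWTotalPositivity, rank 4, verbatim): `∃ C ≠ ⊤, ∀ Ω bounded, δ > 0, u ∼ v in ℤ²,
SAW.weight Ω δ u v univ ≤ C` — by the landed POLYGON normal form
`Negative.criticalBubbleBound_iff_polygonSeries_ne_top` it is ONE number:
`polygonSeries = Σ_N N q_N x_c^N < ∞` (`q_N` = `N`-step self-avoiding polygons of `ℤ²` up to translation;
open since Madras–Slade 1993, p. 37; "`θ > 2` summably").

**Lever (the dictionary).** Kesten's critical renewal structure: i.i.d. irreducible bridges drawn with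
probability `μ^{-|β|}` (a probability law because `Σ_irr x_c^{|β|} = 1`, MS (4.2.4)) make every `x_c`-weighted
sum over BRIDGES an expectation for a heavy-tailed 2D renewal walk; `u_h := Σ_{span W = h} x_c^{|W|}` is the
renewal density at level `h`, pinned bridge masses are Green's functions (MS (8.1.18)). Every polygon class is put
into the product space of TWO independent Kesten walks by the lexicographic two-bridge cut (stub A1, landed):
slicing by the apex column `h`, the crux becomes `Σ_h M₂(h) < ∞` for the length-weighted mass `M₂(h)` of DISJOINT
apex-meeting pairs; the free mass `F(h)` factorises through one-walk quantities (`freePairMass_le`, proved: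
`F(h) ≤ 2 u_h sup_v L(v)`).

**Stubs of the composition** (registered by `ledger skeleton check`; statements `Goal.stub_*`):
* A1 `stub_polygonCut` (LANDED p111040), A2 `stub_cutSum` (LANDED p97099), B2 `stub_renewalBound` (LANDED p103353);
* B1 `stub_pinnedLengthMassBound : PinnedLengthMassBound (1/5)` (XL, OPEN) — `sup_{v₀ = h} Σ_{tip W = v} |W| x_c^{|W|}
  ≤ C (h+1)^{1/5}` (prediction `h^{1/12}`; floors landed: finite per column (c3), `≤ 2μ·4^h` (c4));
* C `stub_disjointnessGain : DisjointnessGain (5/4)` (XL, OPEN, hardest) — `M₂(h) ≤ C (h+1)^{-5/4} F(h)` (prediction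
  `h^{-3/2}`; floor `c = 0` landed);
* `CriticalBubbleBound_of : B1 → C → SAWTotalPositivity.CriticalBubbleBound` through the landed parametric reduction
  `criticalBubbleBound_of_exponents` (`1/5 − 5/4 = −21/20 < −1`) and `CriticalBubbleBound_proof`.

**Disproof.lean used** (Cruxes/CriticalBubbleBound/Disproof.lean gen 5 and the landed `Negative/*`): §18 polygon normal
form; §2 `IsBounded`/`0<δ` idle; §4 fugacity load-bearing (every mass at `x_c`; Kesten's measure exists only there);
§6 no endpoint freed; §14 self-avoidance load-bearing (A's cut, C's avoidance, MS Prop. 8.1.2's reflection);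
§16 proved window (this programme sharpens its upper side from `e^{κ√n}` to `n^{3/2}`); §21/§25 moment ladder (this
programme proves the rung `Σ N^{-s} q_N x_c^N < ∞`, `s > 1/2`; `M_0 = 𝒫` and `M_1 = T` stay open); §24 Targets concern
the docking line only.
-/

noncomputable section

namespace Summit.CriticalPhenomena.SAWScalingLimit.Cruxes.CriticalBubbleBound.KestenProductRenewalDictionary

open Literature.Probability.LatticeModels Literature.Probability.RandomPlanarGeometry
open Literature.Probability.RandomPlanarGeometry.SAW
open Summit.CriticalPhenomena.SAWScalingLimit.Theorems.CriticalBubbleBound.Negative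
open Summit.CriticalPhenomena.SAWScalingLimit.Theorems.CriticalBubbleBound.Kesten
open Literature.Barriers.CriticalPhenomena (isotropicPolygonCount)
open scoped ENNReal NNReal BigOperators
open Classical

/-! ### Objects of the dictionary
All objects (`Bridge`, `columnMass`, `pinnedLengthMass`, `BridgePair`, `ApexMeet`, `AtHeight`, `OnlyApex`,
`pairWeight`, `freePairMass`, `disjointPairMass`, `eUp`) are the TREE's, namespace
`Summit.CriticalPhenomena.SAWScalingLimit.Theorems.CriticalBubbleBound.Kesten`
(`Theorems/SAWTotalPositivityCriticalBubbleBoundKestenDefs.lean`, p96187), opened above. -/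

/-! ### The five stub statements -/

/-- Stub A1 (L, combinatorial, provable now) — **the lexicographic two-bridge cut is an injection**
of polygon classes (canonical SAP words of all lengths, `Negative.CanonSigma`) into apex-meeting,
only-apex bridge pairs of total length `N + 1`. Construction: for a canonical word `w` of length `N`
(`IsCanon`: SAP, rooted at the `key`-least vertex `B = vtx w 0 = 0`, first letter `E`, hence last letter
`S`, `vtx w 1 = (1,0)`, `vtx w (N-1) = (0,1)`, all vertices in `{y ≥ 0}`), let `a ∈ [1, N-1]` be the index of
the `key`-LARGEST vertex (topmost-then-rightmost) and `S i := swap (vtx w i)` (`swap (x,y) = (y,x)`); put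
`W₁ 0 = 0`, `W₁ k = S (N + 1 - k) + e₀` for `1 ≤ k ≤ N + 1 - a` (the last arc read backwards, frozen after),
`W₂ 0 = 0`, `W₂ k = S k + e₀ - e₁` for `1 ≤ k ≤ a` (the first arc, frozen after). Both are bridges
(coordinate `0` is `y + 1 ≥ 1 > 0` and is maximal at `S a`), `W₁.tip = W₂.tip + e₁ = S a + e₀`, lengths
`(N + 1 - a) + a = N + 1`, only-apex (the arcs share only `a`; `W₁ 0 = 0 ≠ e₁`, coordinate `0` separates the
rest), and `(W₁, W₂)` determines `S` on `[0, N]`, hence `w` (`Negative.eq_of_vtx_eq`). -/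
def PolygonCut : Prop :=
  ∃ g : CanonSigma → BridgePair, Function.Injective g ∧
    ∀ p : CanonSigma, ApexMeet (g p) ∧ OnlyApex (g p) ∧ (g p).1.len + (g p).2.len = p.1 + 1

/-- Stub A (target of A1 + A2) — **two-bridge bound** on the polygon normal form of the crux:
`Σ_N N q_N x_c^N ≤ μ · Σ_h M₂(h)`. -/
def TwoBridgeBound : Prop :=
  polygonSeries ≤ ENNReal.ofReal connectiveConstant * ∑' h : ℕ, disjointPairMass h

/- Stub B1 (XL, OPEN), exponent `a` — `PinnedLengthMassBound a` is now the TREE's named conjecture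
`Kesten.PinnedLengthMassBound` (Theorems/SAWTotalPositivityCriticalBubbleBoundKestenReduction.lean, p114776):
`∃ C : ℝ≥0, ∀ (h : ℕ) (v : Site 2), v 0 = h → pinnedLengthMass v ≤ C * ENNReal.ofReal (((h : ℝ) + 1) ^ a)`;
registered at `a = 1/5` since reshape r2 (was `1/4`; prediction `1/12`, MC effective `0.10–0.12` at `h ≤ 32`).
FLOOR (c3, landed p129398): `Strip.pinnedLengthMass_lt_top` (`∀ v, L(v) < ⊤`) and `Strip.exists_pinnedLengthMass_le_of_column`
(`∀ h, ∃ B < ⊤, ∀ v, v₀ = h → L(v) ≤ B`), from the strip gap `Strip.strip_gap` (μ(strip_w) < μ ∀ w); no growth rate in `h`. -/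

/-- Stub B2 (M/L, provable now) — **Kesten's renewal bound** `u_h = B_h(x_c) ≤ 1` for every span `h`
(every bridge of span `h ≥ 1` is uniquely an irreducible bridge of span `j ≥ 1` followed by a bridge of
span `h - j`, and `Σ_irr x_c^{|β|} ≤ 1` by the Kraft inequality at every `x < x_c`; induction on `h`).
In tree so far only as the typed route item `SAWRenewalTightness.StripMassConservation`. -/
def KestenBound : Prop := ∀ h : ℕ, columnMass h ≤ 1

/- Stub C (XL, OPEN, hardest, the bet), exponent `c` — `DisjointnessGain c` is now the TREE's named conjecture
`Kesten.DisjointnessGain` (same file, p114776):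
`∃ C : ℝ≥0, ∀ h : ℕ, disjointPairMass h ≤ C * ENNReal.ofReal (((h : ℝ) + 1) ^ (-c)) * freePairMass h`;
registered at `c = 5/4` since reshape r2 (was `4/3`; prediction `3/2`, MC effective `1.36±0.02` vs `h` / `1.48±0.02` vs `h+1`
at `8 ≤ h ≤ 32`); proved floor `Kesten.disjointnessGain_zero : DisjointnessGain 0`. -/

/-! ### Audit names of the stub statements (`Goal.stub_x` = statement of the registered stub `stub_x`) -/

namespace Goal

/-- Statement of stub A1 `stub_polygonCut` (= `PolygonCut`, displayed expanded so that the stub file can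
state it verbatim over the tree's objects). -/
abbrev stub_polygonCut : Prop :=
  ∃ g : CanonSigma → BridgePair, Function.Injective g ∧
    ∀ p : CanonSigma, ApexMeet (g p) ∧ OnlyApex (g p) ∧ (g p).1.len + (g p).2.len = p.1 + 1

/-- Statement of stub A2 `stub_cutSum` (= `PolygonCut → TwoBridgeBound`, expanded). -/
abbrev stub_cutSum : Prop :=
  (∃ g : CanonSigma → BridgePair, Function.Injective g ∧
    ∀ p : CanonSigma, ApexMeet (g p) ∧ OnlyApex (g p) ∧ (g p).1.len + (g p).2.len = p.1 + 1) →
  polygonSeries ≤ ENNReal.ofReal connectiveConstant * ∑' h : ℕ, disjointPairMass h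

/-- Statement of stub B1 `stub_pinnedLengthMassBound` (reshape r2: exponent `1/5`). -/
abbrev stub_pinnedLengthMassBound : Prop := PinnedLengthMassBound (1 / 5)

/-- Statement of stub B2 `stub_renewalBound` (= `KestenBound`, expanded). -/
abbrev stub_renewalBound : Prop := ∀ h : ℕ, columnMass h ≤ 1

/-- Statement of stub C `stub_disjointnessGain` (reshape r2: exponent `5/4`). -/
abbrev stub_disjointnessGain : Prop := DisjointnessGain (5 / 4)

end Goal

/-! ### Registered stubs -/

/-- Stub A1 (L, LANDED p111040): the lexicographic two-bridge cut of polygon classes is injective. -/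
theorem stub_polygonCut :
    ∃ g : CanonSigma → BridgePair, Function.Injective g ∧
      ∀ p : CanonSigma, ApexMeet (g p) ∧ OnlyApex (g p) ∧ (g p).1.len + (g p).2.len = p.1 + 1 :=
  -- LANDED (p111040): the lexicographic two-bridge cut in the function model
  _root_.Summit.CriticalPhenomena.SAWScalingLimit.Theorems.CriticalBubbleBound.Kesten.Cut.stub_polygonCut

/-- Stub A2 (M, LANDED p97099): summing the cut — `Σ_N N q_N x_c^N ≤ μ Σ_h M₂(h)`. -/
theorem stub_cutSum :
    (∃ g : CanonSigma → BridgePair, Function.Injective g ∧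
      ∀ p : CanonSigma, ApexMeet (g p) ∧ OnlyApex (g p) ∧ (g p).1.len + (g p).2.len = p.1 + 1) →
    polygonSeries ≤ ENNReal.ofReal connectiveConstant * ∑' h : ℕ, disjointPairMass h :=
  -- LANDED (p97099): summation of the cut
  _root_.Summit.CriticalPhenomena.SAWScalingLimit.Theorems.CriticalBubbleBound.Kesten.stub_cutSum

/-- Stub B1 (XL, open): pinned length-weighted bridge mass `≤ C (h+1)^{1/5}` (r2; was `1/4`). -/
theorem stub_pinnedLengthMassBound : PinnedLengthMassBound (1 / 5) := by
  sorry

/-- Stub B2 (M/L, LANDED p103353): Kesten's bound `u_h ≤ 1`. -/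
theorem stub_renewalBound : ∀ h : ℕ, columnMass h ≤ 1 :=
  -- LANDED (p103353): Kesten's bound from the route theorem `stripMassConservation_proof`
  _root_.Summit.CriticalPhenomena.SAWScalingLimit.Theorems.CriticalBubbleBound.Kesten.Cut.stub_renewalBound

/-- Stub C (XL, open, hardest): disjointness gain `≥ 5/4` (r2; was `4/3`). -/
theorem stub_disjointnessGain : DisjointnessGain (5 / 4) := by
  sorry

/-! ### Kernel-checked composition -/

/-- Fubini step (proved): the free pair mass factorises through the one-bridge quantities —
pin the length-weighted bridge at the site dictated by the other one:
`F(h) ≤ 2 · u_h · sup_{v₀ = h} L(v)`. -/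
theorem freePairMass_le (h : ℕ) (B : ℝ≥0∞)
    (hB : ∀ v : Site 2, v 0 = h → pinnedLengthMass v ≤ B) :
    freePairMass h ≤ 2 * (columnMass h * B) := by
  -- the two summands of the length weight, each pinned at the site forced by the other bridge
  let f₁ : BridgePair → ℝ≥0∞ := fun p =>
    (if p.2.span = h then p.2.mass else 0) *
      (if p.1.tip = p.2.tip + eUp then (p.1.len : ℝ≥0∞) * p.1.mass else 0)
  let f₂ : BridgePair → ℝ≥0∞ := fun p =>
    (if p.1.span = h then p.1.mass else 0) *
      (if p.2.tip = p.1.tip - eUp then (p.2.len : ℝ≥0∞) * p.2.mass else 0)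
  have hterm : ∀ p : BridgePair,
      (if ApexMeet p ∧ AtHeight h p then pairWeight p else 0) ≤ f₁ p + f₂ p := by
    intro p
    by_cases hp : ApexMeet p ∧ AtHeight h p
    · obtain ⟨hA, hH⟩ := hp
      have hA' : p.1.tip = p.2.tip + eUp := hA
      have hH' : p.1.span = h := hH
      have h2span : p.2.span = h := by
        have := congrFun hA' 0
        simp only [Pi.add_apply, eUp_zero, add_zero] at this
        rw [← hH']
        exact this.symm
      have hB2 : p.2.tip = p.1.tip - eUp := by rw [hA', add_sub_cancel_right]
      rw [if_pos ⟨hA, hH⟩]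
      simp only [f₁, f₂, if_pos h2span, if_pos hA', if_pos hH', if_pos hB2, pairWeight]
      apply le_of_eq
      ring
    · rw [if_neg hp]
      exact zero_le
  have hpin₁ : ∀ b : Bridge, b.span = h → pinnedLengthMass (b.tip + eUp) ≤ B := fun b hb =>
    hB _ (by simp [hb])
  have hpin₂ : ∀ a : Bridge, a.span = h → pinnedLengthMass (a.tip - eUp) ≤ B := fun a ha =>
    hB _ (by simp [ha])
  calc freePairMass h
      ≤ ∑' p : BridgePair, (f₁ p + f₂ p) := ENNReal.tsum_le_tsum hterm
    _ = (∑' p : BridgePair, f₁ p) + ∑' p : BridgePair, f₂ p := ENNReal.tsum_add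
    _ ≤ columnMass h * B + columnMass h * B := by
        gcongr
        · -- sum over the second bridge outermost
          rw [ENNReal.tsum_prod', ENNReal.tsum_comm]
          calc ∑' (b : Bridge) (a : Bridge), f₁ (a, b)
              = ∑' b : Bridge, (if b.span = h then b.mass else 0) *
                  ∑' a : Bridge, (if a.tip = b.tip + eUp then (a.len : ℝ≥0∞) * a.mass else 0) := by
                refine tsum_congr fun b => ?_
                rw [← ENNReal.tsum_mul_left]
            _ ≤ ∑' b : Bridge, (if b.span = h then b.mass else 0) * B := by
                refine ENNReal.tsum_le_tsum fun b => ?_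
                by_cases hb : b.span = h
                · rw [if_pos hb]
                  exact mul_le_mul' le_rfl (hpin₁ b hb)
                · rw [if_neg hb, zero_mul, zero_mul]
            _ = columnMass h * B := ENNReal.tsum_mul_right
        · rw [ENNReal.tsum_prod']
          calc ∑' (a : Bridge) (b : Bridge), f₂ (a, b)
              = ∑' a : Bridge, (if a.span = h then a.mass else 0) *
                  ∑' b : Bridge, (if b.tip = a.tip - eUp then (b.len : ℝ≥0∞) * b.mass else 0) := by
                refine tsum_congr fun a => ?_
                rw [← ENNReal.tsum_mul_left]
            _ ≤ ∑' a : Bridge, (if a.span = h then a.mass else 0) * B := by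
                refine ENNReal.tsum_le_tsum fun a => ?_
                by_cases ha : a.span = h
                · rw [if_pos ha]
                  exact mul_le_mul' le_rfl (hpin₂ a ha)
                · rw [if_neg ha, zero_mul, zero_mul]
            _ = columnMass h * B := ENNReal.tsum_mul_right
    _ = 2 * (columnMass h * B) := (two_mul _).symm

/-- Exponent bookkeeping (proved): `(h+1)^{-c} (h+1)^{a} = (h+1)^{a-c}` in `ℝ≥0∞`. -/
theorem rpow_pair (a c : ℝ) {t : ℝ} (ht : 0 < t) :
    ENNReal.ofReal (t ^ (-c)) * ENNReal.ofReal (t ^ a) = ENNReal.ofReal (t ^ (a - c)) := by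
  rw [← ENNReal.ofReal_mul (Real.rpow_nonneg ht.le _), ← Real.rpow_add ht]
  congr 2
  ring

/-- Summation step (proved): a `p`-series bound with exponent `s < -1` on the sliced disjoint pair
masses makes their total finite. -/
theorem tsum_disjointPairMass_ne_top {K : ℝ≥0∞} (hK : K ≠ ⊤) {s : ℝ} (hs : s < -1)
    (hle : ∀ h : ℕ, disjointPairMass h ≤ K * ENNReal.ofReal (((h : ℝ) + 1) ^ s)) :
    ∑' h : ℕ, disjointPairMass h ≠ ⊤ := by
  refine ne_top_of_le_ne_top ?_ (ENNReal.tsum_le_tsum hle)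
  rw [ENNReal.tsum_mul_left]
  refine ENNReal.mul_ne_top hK ?_
  have hsum : Summable fun n : ℕ => ((n : ℝ) + 1) ^ s := by
    have h1 : Summable fun n : ℕ => ((n : ℝ)) ^ s := Real.summable_nat_rpow.2 hs
    simpa using (summable_nat_add_iff 1).2 h1
  rw [← ENNReal.ofReal_tsum_of_nonneg (fun n => Real.rpow_nonneg (by positivity) _) hsum]
  exact ENNReal.ofReal_ne_top

/-- **The parametric composition** (concluding the polygon normal form, so that the checker sees ONE
theorem concluding the crux): two-bridge bound, pinned length mass at exponent `a`, Kesten's bound and a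
disjointness gain `c` with `a - c < -1` give `polygonSeries < ∞`. Chain: C bounds `M₂(h)` by
`(h+1)^{-c} F(h)`; the Fubini step, `u_h ≤ 1` and B1 bound `F(h)` by `2 C₃ (h+1)^a`; the exponents
add to `a - c < -1`, so `Σ_h M₂(h) < ∞`; A bounds `polygonSeries` by `μ Σ_h M₂(h) < ∞`. -/
theorem polygonSeries_ne_top_of_exponents {a c : ℝ} (hac : a - c < -1) :
    TwoBridgeBound → PinnedLengthMassBound a → KestenBound → DisjointnessGain c →
      polygonSeries ≠ ⊤ := by
  intro hA hB1 hB2 hC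
  obtain ⟨C₁, hC₁⟩ := hC
  obtain ⟨C₃, hC₃⟩ := hB1
  -- per-column bound with summable exponent
  have hcol : ∀ h : ℕ, disjointPairMass h ≤
      (2 * C₁ * C₃ : ℝ≥0∞) * ENNReal.ofReal (((h : ℝ) + 1) ^ (a - c)) := by
    intro h
    have ht : (0 : ℝ) < (h : ℝ) + 1 := by positivity
    have hF : freePairMass h ≤ 2 * (columnMass h *
        ((C₃ : ℝ≥0∞) * ENNReal.ofReal (((h : ℝ) + 1) ^ a))) :=
      freePairMass_le h _ (fun v hv => hC₃ h v hv)
    have hF' : freePairMass h ≤ 2 * (1 * ((C₃ : ℝ≥0∞) * ENNReal.ofReal (((h : ℝ) + 1) ^ a))) :=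
      hF.trans (by gcongr; exact hB2 h)
    calc disjointPairMass h
        ≤ (C₁ : ℝ≥0∞) * ENNReal.ofReal (((h : ℝ) + 1) ^ (-c)) * freePairMass h := hC₁ h
      _ ≤ (C₁ : ℝ≥0∞) * ENNReal.ofReal (((h : ℝ) + 1) ^ (-c)) *
            (2 * (1 * ((C₃ : ℝ≥0∞) * ENNReal.ofReal (((h : ℝ) + 1) ^ a)))) := by
          gcongr
      _ = (2 * C₁ * C₃ : ℝ≥0∞) *
            (ENNReal.ofReal (((h : ℝ) + 1) ^ (-c)) * ENNReal.ofReal (((h : ℝ) + 1) ^ a)) := by ring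
      _ = (2 * C₁ * C₃ : ℝ≥0∞) * ENNReal.ofReal (((h : ℝ) + 1) ^ (a - c)) := by
          rw [rpow_pair a c ht]
  have hK : (2 * C₁ * C₃ : ℝ≥0∞) ≠ ⊤ :=
    ENNReal.mul_ne_top (ENNReal.mul_ne_top ENNReal.ofNat_ne_top ENNReal.coe_ne_top) ENNReal.coe_ne_top
  have hsum : ∑' h : ℕ, disjointPairMass h ≠ ⊤ := tsum_disjointPairMass_ne_top hK hac hcol
  -- the polygon series is finite
  exact ne_top_of_le_ne_top (ENNReal.mul_ne_top ENNReal.ofReal_ne_top hsum) hA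

/-- **The composition over the two OPEN stubs** (c2 integration, reshape r2): B1 and C imply the crux BY NAME, the
landed stubs A1, A2, B2 being discharged inside (`1/5 - 5/4 = -21/20 < -1`). -/
theorem CriticalBubbleBound_of :
    Goal.stub_pinnedLengthMassBound → Goal.stub_disjointnessGain →
      _root_.Summit.CriticalPhenomena.SAWScalingLimit.Theses.SAWTotalPositivity.CriticalBubbleBound :=
  fun hB1 hC =>
    -- the LANDED parametric reduction (p114776) over the landed cut / Kesten bound / exponent bookkeeping,
    -- at the reshape-r2 point (a, c) = (1/5, 5/4): 1/5 - 5/4 = -21/20 < -1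
    criticalBubbleBound_of_exponents (a := 1 / 5) (c := 5 / 4) (by norm_num) hC hB1

/-- The same composition through this file's own polygon-normal-form chain (kept as a cross-check
that the skeleton's in-file composition agrees with the landed one). -/
theorem CriticalBubbleBound_of' :
    Goal.stub_pinnedLengthMassBound → Goal.stub_disjointnessGain →
      _root_.Summit.CriticalPhenomena.SAWScalingLimit.Theses.SAWTotalPositivity.CriticalBubbleBound :=
  fun hB1 hC =>
    criticalBubbleBound_iff_polygonSeries_ne_top.2
      (polygonSeries_ne_top_of_exponents (a := 1 / 5) (c := 5 / 4) (by norm_num)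
        (stub_cutSum stub_polygonCut) hB1 stub_renewalBound hC)

/-- The skeleton as a (sorried-through-the-stubs) proof of the crux: `_of` applied to the stubs. -/
theorem CriticalBubbleBound_proof :
    _root_.Summit.CriticalPhenomena.SAWScalingLimit.Theses.SAWTotalPositivity.CriticalBubbleBound :=
  CriticalBubbleBound_of stub_pinnedLengthMassBound stub_disjointnessGain

/-! ### c5 programme — Madras–Slade §8.1 for `ℤ²` (`α_sing ≤ 3/2`): the infrastructure stub STATEMENTS
(registered on the crux item with `ledger workitem stub-add`; proved in
`Theorems/SAWTotalPositivityCriticalBubbleBoundKestenMS*.lean`, namespace `…Theorems.CriticalBubbleBound.Kesten.MS`;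
no `sorry` here — these `abbrev`s only certify that the registered signatures elaborate). -/

namespace C5

/-- A `ms_canon_le_upArch` — canonical SAP words of length `N` (tree: `Negative.canonSet`, rooted at the
lowest-then-leftmost vertex, first letter `E`) read BACKWARDS are up-first arches: `(N-1)`-step SAWs `0 → e₀` with
first step `+e₁` staying in `{y ≥ 0}`; injectively. [cite: MadrasSlade1993, Proposition 8.1.2] -/
abbrev ms_canon_le_upArch : Prop :=
  ∀ N : ℕ, (canonSet N).card ≤
    ((Zd.sawFun 2 (N - 1) e₀).filter (fun ω => ω 1 = eUp ∧ ∀ j ≤ N - 1, 0 ≤ ω j 1)).card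

/-- B `ms_upArch_le_pinnedBridges` — MS Prop. 8.1.2 (`d = 2`): reflecting an up-first arch after its first topmost
vertex in the horizontal line through it, prepending a unit step and swapping coordinates gives an `(n+1)`-step
bridge (tree convention: coordinate `0`) whose endpoint has transversal coordinate `1`; injectively.
[cite: MadrasSlade1993, Proposition 8.1.2] -/
abbrev ms_upArch_le_pinnedBridges : Prop :=
  ∀ n : ℕ, ((Zd.sawFun 2 n e₀).filter (fun ω => ω 1 = eUp ∧ ∀ j ≤ n, 0 ≤ ω j 1)).card ≤
    ((Zd.bridges 2 (n + 1)).filter (fun ζ => ζ (n + 1) 1 = 1)).card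

/-- C `ms_irrBridge_reflect` — the reflection `y ↦ -y` (letters `N ↔ S`) is an involution of step words
preserving irreducible bridges and lengths and negating the transversal displacement; and the two-letter word
`EN` is an irreducible bridge with transversal displacement `1`. [cite: MadrasSlade1993, Lemma 8.1.8] -/
abbrev ms_irrBridge_reflect : Prop :=
  (∃ r : List Step → List Step, Function.Involutive r ∧ ∀ w : List Step,
      (IsIrrBridge w → IsIrrBridge (r w)) ∧ (r w).length = w.length ∧
        wEnd (r w) 1 = -wEnd w 1 ∧ wEnd (r w) 0 = wEnd w 0) ∧
    (IsIrrBridge [0, 1] ∧ wEnd [0, 1] 1 = 1)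

/-- D `ms_littlewoodOfford` — Erdős–Littlewood–Offord for sign patterns: for integers `a_k`, the number of
`ε ∈ {±1}^m` with `Σ_k ε_k a_k = y` is `≤ 2^{m-K} · C(K, ⌊K/2⌋) ≤ √2 · 2^m / √(K+1)`, `K = #{k : a_k ≠ 0}`
(level sets are antichains on the support: Sperner; central binomial `C(2n,n)²(n+1) ≤ 16ⁿ`). [cite: MadrasSlade1993, Lemma 8.1.3] -/
abbrev ms_littlewoodOfford : Prop :=
  ∀ (m : ℕ) (a : Fin m → ℤ) (y : ℤ),
    (((Finset.univ : Finset (Fin m → Bool)).filter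
        (fun ε => (∑ k, (if ε k then a k else -a k)) = y)).card : ℝ) ≤
      Real.sqrt 2 * 2 ^ m / Real.sqrt (((Finset.univ : Finset (Fin m)).filter (fun k => a k ≠ 0)).card + 1)

/-- E `ms_signAveraging` — for a weight `μ` on a type `I` invariant under an involution `ρ` that negates an integer
charge `q`, the `μ^{⊗m}`-mass of `m`-tuples of total charge `y` is at most `√2 · Σ_s Π_k μ(s_k) · (K(s)+1)^{-1/2}`,
`K(s) = #{k : q(s_k) ≠ 0}` (average over the `2^m` sign flips, then Littlewood–Offord pointwise — taken as a
hypothesis, statement D). [cite: MadrasSlade1993, Lemma 8.1.3] -/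
abbrev ms_signAveraging : Prop :=
  ∀ {I : Type} (μ : I → ℝ≥0∞) (ρ : I → I) (q : I → ℤ), Function.Involutive ρ →
    (∀ i, μ (ρ i) = μ i) → (∀ i, q (ρ i) = -q i) →
    (∀ (m : ℕ) (a : Fin m → ℤ) (y : ℤ),
      (((Finset.univ : Finset (Fin m → Bool)).filter
          (fun ε => (∑ k, (if ε k then a k else -a k)) = y)).card : ℝ) ≤
        Real.sqrt 2 * 2 ^ m / Real.sqrt (((Finset.univ : Finset (Fin m)).filter (fun k => a k ≠ 0)).card + 1)) →
    ∀ (m : ℕ) (y : ℤ),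
      (∑' s : Fin m → I, if (∑ k, q (s k)) = y then ∏ k, μ (s k) else 0) ≤
        ENNReal.ofReal (Real.sqrt 2) * ∑' s : Fin m → I, (∏ k, μ (s k)) *
          ENNReal.ofReal (1 / Real.sqrt (((Finset.univ : Finset (Fin m)).filter (fun k => q (s k) ≠ 0)).card + 1))

/-- F `ms_binomialMoment` — under a sub-probability product weight, `Σ_s Π_k μ(s_k) (K(s)+1)^{-1/2} ≤ (p(m+1))^{-1/2}`
whenever the non-zero charges carry mass `≥ p > 0` (`(K+1)^{-1/2} ≤ λ/2 + 1/(2λ(K+1))`, the binomial identity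
`Σ_j C(m,j) P^j Z^{m-j}/(j+1) ≤ 1/((m+1)P)`, `λ = (p(m+1))^{-1/2}`). [cite: MadrasSlade1993, Lemma 8.1.3] -/
abbrev ms_binomialMoment : Prop :=
  ∀ {I : Type} (μ : I → ℝ≥0∞) (q : I → ℤ) (p : ℝ), 0 < p → (∑' i, μ i) ≤ 1 →
    ENNReal.ofReal p ≤ (∑' i, if q i ≠ 0 then μ i else 0) →
    ∀ m : ℕ, (∑' s : Fin m → I, (∏ k, μ (s k)) *
        ENNReal.ofReal (1 / Real.sqrt (((Finset.univ : Finset (Fin m)).filter (fun k => q (s k) ≠ 0)).card + 1))) ≤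
      ENNReal.ofReal (1 / Real.sqrt (p * (m + 1)))

/-- G `ms_irrFactorisation` — Kesten's FULL factorisation: concatenating an `m`-tuple of irreducible bridges gives a
self-avoiding bridge word, the map from `Σ_m Irr^m` is injective, and every self-avoiding bridge word is reached
(iterate the first-factor cut `StripMass.exists_irrBridge_append`; uniqueness `eq_of_append_eq'`).
[cite: MadrasSlade1993, §4.2, eq. (4.2.2); (8.1.14)–(8.1.18)] -/
abbrev ms_irrFactorisation : Prop :=
  (∀ (m : ℕ) (s : Fin m → {w : List Step // IsIrrBridge w}),
      IsSAW (List.ofFn (fun k => (s k).1)).flatten ∧ IsBridgeW (List.ofFn (fun k => (s k).1)).flatten) ∧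
    Function.Injective
      (fun x : (Σ m : ℕ, (Fin m → {w : List Step // IsIrrBridge w})) => (List.ofFn (fun k => (x.2 k).1)).flatten) ∧
    (∀ w : List Step, IsSAW w → IsBridgeW w →
      ∃ x : (Σ m : ℕ, (Fin m → {w : List Step // IsIrrBridge w})), (List.ofFn (fun k => (x.2 k).1)).flatten = w)

/-- H `ms_pinnedBridgeMass_antitone` (lead) — MS Prop. 8.1.4 for `ℤ²` in the word model: for every non-increasing
`h : ℕ → [0,∞]` and every transversal level `y`, `Σ_{w self-avoiding bridge word, wEnd w 1 = y} h(|w|) x_c^{|w|}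
≤ (√2 / x_c) · Σ_m h(m) (m+1)^{-1/2}` (full factorisation + Kesten's identity + anti-concentration with `p = x_c²`).
[cite: MadrasSlade1993, Proposition 8.1.4] -/
abbrev ms_pinnedBridgeMass_antitone : Prop :=
  ∀ (h : ℕ → ℝ≥0∞), Antitone h → ∀ y : ℤ,
    (∑' w : {w : List Step // IsSAW w ∧ IsBridgeW w ∧ wEnd w 1 = y},
        h w.1.length * ENNReal.ofReal (criticalFugacity ^ w.1.length)) ≤
      ENNReal.ofReal (Real.sqrt 2 / criticalFugacity) * ∑' m : ℕ, h m * ENNReal.ofReal (1 / Real.sqrt ((m : ℝ) + 1))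

/-- TARGET of the programme in crux currency (proved in the lead's assembly from A, B, H; LANDED p134428): for every
non-increasing `h`, `Σ_N h(N) q_N x_c^N ≤ 2√2 μ · Σ_m h(m) (m+1)^{-1/2}` (`q_N = isotropicPolygonCount N`; MS Cor. 8.1.5
with `C' = 2√2 μ`: `q_N ≤ #canonSet N ≤ b_N^{(1)}` with no symmetry factor since canonical arches all end at `+e₀`,
and `√2/x_c = √2 μ ≤ 2√2 μ`). [cite: MadrasSlade1993, Corollary 8.1.5] -/
abbrev ms_polygon_antitone : Prop :=
  ∀ (h : ℕ → ℝ≥0∞), Antitone h →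
    (∑' N : ℕ, h N * (isotropicPolygonCount N : ℝ≥0∞) * ENNReal.ofReal (criticalFugacity ^ N)) ≤
      ENNReal.ofReal (2 * Real.sqrt 2 * connectiveConstant) *
        ∑' m : ℕ, h m * ENNReal.ofReal (1 / Real.sqrt ((m : ℝ) + 1))

end C5

end Summit.CriticalPhenomena.SAWScalingLimit.Cruxes.CriticalBubbleBound.KestenProductRenewalDictionary

end
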